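import Summits.BirchSwinnertonDyer.BirchSwinnertonDyer.Theorems.ByReductionTypeAtTwoMultTransportOfPrint49
import Summits.BirchSwinnertonDyer.BirchSwinnertonDyer.Theorems.ByReductionTypeAtTwoMultTransportP49KernelLEO
import HarnessLib

/-!
# T-42-mult in the kernel, LVII — the multiplicative congruence transport at `2` FROM NAMED PRINTED FACTS ONLY

Cell `bsd-2adic` (run/shared/lean/pub/bsd-2adic/), seat `bsd-2adic-t42` GEN 19. HONEST FRAMING: research route;
THEOREMS ONLY; nothing booked; BSD is not proved by any of this. PARTITION: X5@2 multiplicative GV-transport rows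
(K4ᵐ B1·O1) — the seat's minted target «`multCongruenceTransportAtTwo_of_print : <named PUB facts> →
MultCongruenceTransportAtTwo …`» with the binder P49 (Greenberg LNM 1716 Prop. 4.9, typed
`Greenberg1999.prop49_noFiniteSubmodule_H1Sigma`) REPLACED by its kernel derivation
`P49Kernel.prop49_noFiniteSubmodule_H1Sigma_of_facts` (file LVI) from the five engine facts
{Greenberg 2006 Prop. 5.2, Prop. 6.3, Thm. 1 (i); Harari Thm. 17.13 (b), (a) for `ℚ`}.

## What

* **`multCongruenceTransportAtTwo_of_printFacts`** — `MultCongruenceTransportAtTwo W x W' x'` for every pair of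
  minimal elliptic `W, W'/ℚ` with an odd prime in `N(W') N(W)`, from the NINE named printed facts
  {F1 = GV Cor. 2.3/Lemma 2.4 at 2, F3a = Greenberg Lemma 4.5 (i) at 2, Gr06 5.2, Gr06 6.3, Gr06 Thm 1 (i),
   PT 17.13 (b), PT 17.13 (a), Greenberg 5.14 at 2, A111 = im Kummer ⊇ Greenberg condition} — no LEO / Leopoldt-type
  input, no conjecture-grade binder. It is `multCongruenceTransportAtTwo_of_print49` (file XLII) with
  `h49 := prop49_noFiniteSubmodule_H1Sigma_of_facts h52 h63 hT1 hPTb hPTa`.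

The class-level re-point of the door files stays the pen's batch (RC-315 (a) / RC-337); this file only provides the
kernel theorem by name. References: [GreenbergVatsal2000] §2; [GreenbergLNM1716] §4 Prop. 4.9, Lemma 4.5, Prop. 5.14;
[Greenberg2006] Thm. 1, Props. 5.2, 6.3; [Harari2020] Thm. 17.13.
-/

set_option autoImplicit false
set_option linter.dupNamespace false

noncomputable section

open scoped Classical

namespace Summit.BirchSwinnertonDyer.BirchSwinnertonDyer.Theorems.MultTransportAtTwo

open WeierstrassCurve Literature.NumberTheory.EllipticCurves
  Literature.NumberTheory.EllipticCurves.Greenberg1999 Literature.NumberTheory.EllipticCurves.GreenbergVatsal2000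
  Literature.NumberTheory.EllipticCurves.Matsuno2008
  Literature.NumberTheory.GaloisCohomology
  Literature.NumberTheory.IwasawaTheory.Greenberg2006 Literature.NumberTheory.IwasawaTheory.Greenberg2016
  Summit.BirchSwinnertonDyer.Rank1Residual Summit.BirchSwinnertonDyer.Rank1Residual.X5.O1
  Summit.BirchSwinnertonDyer.BirchSwinnertonDyer.Theorems.MultKatoInputs
  Summit.BirchSwinnertonDyer.BirchSwinnertonDyer.Theorems.MultKatoRat
  Summit.BirchSwinnertonDyer.BirchSwinnertonDyer.Theorems.MultTransportTwistedDescent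

/-- **THE MULTIPLICATIVE CONGRUENCE TRANSPORT AT `2` FROM NAMED PRINTED FACTS ONLY** (seat target T-42-mult):
`MultCongruenceTransportAtTwo W x W' x'` for minimal elliptic `W, W'/ℚ` with an odd prime dividing `N(W') N(W)`,
granted F1, F3a, Greenberg 2006 Prop. 5.2 / Prop. 6.3 / Thm. 1 (i), Poitou–Tate 17.13 (b)/(a) for `ℚ`,
Greenberg Prop. 5.14 at `2` and A111 — Greenberg's Prop. 4.9 (the former binder P49) is now the kernel theorem
`P49Kernel.prop49_noFiniteSubmodule_H1Sigma_of_facts`.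
[cite: GreenbergVatsal2000, §2 pp. 14–17] [cite: GreenbergLNM1716, §4 Lemma 4.5 (i), Prop. 4.9, Prop. 5.14]
[cite: Greenberg2006, Thm. 1, Props. 3.2, 5.2, 6.3] [cite: Harari2020, Thm. 17.13] -/
theorem multCongruenceTransportAtTwo_of_printFacts
    (hF1 : cor23_lemma24_nonPrimitive_invariants_two)
    (hF3a : lemma45i_noFiniteSubmodule_nonPrimitive_goodOrd_two)
    (h52 : prop52_localH2_torsionBy_injective) (h63 : prop63_shaAway_smul_surjective)
    (hT1 : thm1_sha2_isCoreflexive)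
    (hPTb : poitouTate_shaRestricted_tateDual ℚ) (hPTa : poitouTate_restricted_three_le ℚ)
    (h514 : prop514_isTorsion_mu_eq_zero_two) (hA111 : imKummer_ge_greenbergCondition_at_p)
    (W : WeierstrassCurve ℚ) [W.IsElliptic] [W.IsGloballyMinimal] (x : ℚ)
    (W' : WeierstrassCurve ℚ) [W'.IsElliptic] [W'.IsGloballyMinimal] (x' : ℚ)
    (hodd : ∃ ℓ ∈ (W'.conductorNorm ℤ * W.conductorNorm ℤ).primeFactors, ℓ ≠ 2) :
    MultCongruenceTransportAtTwo W x W' x' :=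
  multCongruenceTransportAtTwo_of_print49 hF1 hF3a
    (P49Kernel.prop49_noFiniteSubmodule_H1Sigma_of_facts h52 h63 hT1 hPTb hPTa) h514 hA111 W x W' x' hodd

end Summit.BirchSwinnertonDyer.BirchSwinnertonDyer.Theorems.MultTransportAtTwo

end
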